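import Mathlib
import HarnessLib

/-!
# The "√7 identity" for `L₋₇(2)` (Bailey–Borwein–Broadhurst–Zudilin 2010, §5) — named fact

D. H. Bailey, J. M. Borwein, D. Broadhurst, W. Zudilin, *Experimental mathematics and mathematical
physics*, in: Gems in Experimental Mathematics, Contemp. Math. 517 (2010) 41–58, §5 "Clausen
functions and hyperbolic volumes" (arXiv:1005.0414, p. 7), printed statements:

* the primitive Dirichlet L-series modulo 7 at `2`: "`L₋₇(2) := Σ_{n>0} (n/7)/n²` … where `(n/7)` is
  the Legendre symbol" — `LMinusSevenTwo` below;
* eq. (arctan) [their (12), "rewritten in equivalent and more self-contained form" of the Clausen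
  identity `3 Cl₂(α) − 3 Cl₂(2α) + Cl₂(3α) = (7√7/4) L₋₇(2)`, `α = 2 arctan √7`]:

  `(24/(7√7)) ∫_{π/3}^{π/2} log |(tan t + √7)/(tan t − √7)| dt = L₋₇(2)`;

* status in print: "we were able to numerically evaluate this integral to 20,000-digit accuracy …
  The two values agreed to 19,995 digits" and "We shall now provide a proof of Eqn. (clausen) and
  hence of Eqn. (arctan)" — the proof (pp. 7–8) rests on Zagier's two formulas for
  `ζ_{ℚ(√−7)}(2)` [Zagier1986, (5) = (6), p. 287, and Thm 3], i.e. on Humbert's covolume formula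
  `Vol(ℍ³/PSL₂(O_K)) = |d|^{3/2} ζ_K(2)/(4π²)` [Zagier1986, p. 299, citing Thurston's notes
  Thm 7.4.1]. Zagier (1986, p. 287): "I know of no direct proof, for instance, of the equality of
  the righthand sides of Eq. (5) and (6)."

Vendored AS PRINTED as the named fact `BaileyEtAl2010_sqrt7_identity` (a `Prop`, not proved here).
It is the real-number shadow, at `d = 7`, of the rules-level crux
`Summit.KontsevichZagierPeriods.KontsevichZagierPeriods.Theses.BianchiHumbert.HumbertSeven`
(stmt-KontsevichZagierPeriods-4281: the quarter Ford-domain double integral of `1/(7−7x²−v²)` is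
KZ-equivalent to the rational double integral for `(7/48) L₋₇(2)`); by soundness of the KZ moves the
crux implies the equality of VALUES, which is this identity up to the elementary passages
(Ford-domain `t`-integration, Clausen integral representation, geometric-series expansion of
`L₋₇(2)`) recorded in the route file. A refuting invariant for the crux must therefore be
non-evaluative.

The integrand has an integrable logarithmic singularity at `t = arctan √7 ∈ (π/3, π/2)`
(loc. cit., p. 7); the interval integral below is Mathlib's (Bochner/Lebesgue) `∫ t in a..b`.

## References

* D. H. Bailey, J. M. Borwein, D. Broadhurst, W. Zudilin, Contemp. Math. 517 (2010), §5, eqs.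
  (clausen), (arctan) = (11), (12) (arXiv:1005.0414 p. 7). [BaileyEtAl2010]
* D. H. Bailey, J. M. Borwein, V. Kapoor, E. W. Weisstein, *Ten problems in experimental
  mathematics*, Amer. Math. Monthly 113 (2006), eqs. (12)–(13). [BaileyEtAl2006]
* D. Zagier, *Hyperbolic manifolds and special values of Dedekind zeta-functions*, Invent. Math. 83
  (1986) 285–301, (5), (6) p. 287; Thm 3 and p. 299. [Zagier1986]
-/

noncomputable section

namespace Literature.NumberTheory.Transcendental

open Real MeasureTheory intervalIntegral

/-- `L₋₇(2) := Σ_{n>0} (n/7)/n²`, the primitive Dirichlet L-series modulo `7` at `s = 2`, `(n/7)`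
the Legendre symbol (= `jacobiSym n 7`; the `n = 0` term is `0`). Numerically `1.1519254705…`.
[cite: BaileyEtAl2010, §5 (definition of L₋₇(2), arXiv p. 7)] -/
def LMinusSevenTwo : ℝ := ∑' n : ℕ, ((jacobiSym (n : ℤ) 7 : ℤ) : ℝ) / (n : ℝ) ^ 2

/-- **The √7 identity** (Bailey–Borwein–Broadhurst–Zudilin 2010, §5, eq. (arctan); proved there
from Zagier 1986 (5) = (6), i.e. from Humbert's covolume formula for `PSL₂(O_{ℚ(√−7)})`):
`(24/(7√7)) ∫_{π/3}^{π/2} log |(tan t + √7)/(tan t − √7)| dt = L₋₇(2)`.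
Real-value shadow of `Summit.KontsevichZagierPeriods.KontsevichZagierPeriods.Theses.BianchiHumbert.HumbertSeven`.
Named fact, not proved here. [cite: BaileyEtAl2010, §5 eq. (arctan)] -/
def BaileyEtAl2010_sqrt7_identity : Prop :=
  24 / (7 * Real.sqrt 7) *
      ∫ t in (π / 3)..(π / 2), Real.log |(Real.tan t + Real.sqrt 7) / (Real.tan t - Real.sqrt 7)| =
    LMinusSevenTwo

/-- The Clausen-function form of the same identity (loc. cit., eq. (clausen), "as is recorded in
[BaileyEtAl2006]"): `3 Cl₂(α) − 3 Cl₂(2α) + Cl₂(3α) = (7√7/4) L₋₇(2)` with `α = 2 arctan √7` and the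
Clausen function given by its series `Cl₂(θ) = Im Σ_{n≥1} e^{inθ}/n² = Σ_{n≥1} sin(nθ)/n²` (loc. cit.,
p. 7). (Transcription check this session: both sides `= 5.33348956690` to `3·10⁻¹²`.) Named fact, not
proved here. [cite: BaileyEtAl2010, §5 eq. (clausen)] -/
def BaileyEtAl2010_sqrt7_clausen : Prop :=
  let Cl₂ : ℝ → ℝ := fun θ => ∑' n : ℕ, Real.sin (n * θ) / (n : ℝ) ^ 2
  let α : ℝ := 2 * Real.arctan (Real.sqrt 7)
  3 * Cl₂ α - 3 * Cl₂ (2 * α) + Cl₂ (3 * α) = 7 * Real.sqrt 7 / 4 * LMinusSevenTwo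

end Literature.NumberTheory.Transcendental
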